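import Summits.Ventures.CertifiedManyBodySolver.Certificates.HubbardSquare_acu2x4_words_naccocM_M36
import Summits.Ventures.CertifiedManyBodySolver.Downfold.BoxesCCOC
import Summits.Ventures.CertifiedManyBodySolver.Downfold.ThermalAnnexSeam
import Literature.MathematicalPhysics.QuantumLattice.HubbardTTPrimeFreeSandwichBoxWords
import HarnessLib

/-!
# hubbard-box-p2's HYPOTHESIS-FREE `acu2x4` CAP on the typed Na-CCOC OBJECT-M box `boxCCOCM_M36` — the one typed cell where the kernel open-cluster witness
# planes (`Certificates/HubbardSquare_acu2x4_words_naccocM_M36.lean`, 21:4xZ) beat the closed AF-chord cap: object-M word (kinematic + decimal) and the T-AXIS annex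

Venture CertifiedManyBodySolver, cell `pub/hubbard-downfold` (stage S1 ↔ S2 seam, D-0099 T axis), seat hubbard-downfold-mod-1; namespace
`Summit.Ventures.CertifiedManyBodySolver.Downfold`. box-p2's `acuw_<cell>_word2` = kernel `acf2x2` floor ∧ kernel `acu2x4` witness-plane cap (chorded in the
density, glued over the cell), HYPOTHESIS-FREE. Surveyed on every typed cell (tools/scan_best.py 21:5xZ): the new caps lose to the closed AF-chord caps already typed
on the La-214 E columns, Na-CCOC E, NdNiO₂ and cell #1 (e.g. cell #1 −0.5239 vs −0.5745), and WIN on the Na-CCOC object-M cell: `acuw_naccocM_M36_word2`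
**[-1.2888648, -0.4174101]** vs the AF-chord M cap −0.3867404523. This file:
* `boxCCOCM_M36_word_acu_kinematic / _decimal` — through `boxCCOCM_M36_energyWord_kinematic` (allowance `(16/π²)(0.179) ≤ 0.291`): decimal **[-1.58, -0.126]**
  (was [−1.580, −0.095] with the AF-chord cap);
* `boxCCOCM_M36_ttPrimeThermalAnnex_acu` — HYPOTHESIS-FREE T axis (t–t′ truncation, `t₁ = 21/50` eV): caps `T ≤ 300 K` **-0.3320800376** (was −0.3009), `100 K` **-0.3889667459** (was −0.3580).
(The La-214 object-M acu cap −0.4158 beats the v1.10 AF-chord cap −0.4121 by 0.004 only and sits on the v1 cell `U ≥ 6.3`; not typed.)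
HONEST FRAMING: T = 0 object-M energy word (kinematic `t″` allowance) and a canonical-sector Gibbs window for the `t–t′` TRUNCATION, HYPOTHESIS-FREE (kernel ED floors,
kernel witness planes, convexity in `n`, concavity gluing, the annex's entropy bound); zeroth-order; nothing here is an order word, a pairing statement, a `T_c` or a
phase sentence. Everything is PROVED; no definition, no `sorry`.
-/

noncomputable section

namespace Summit.Ventures.CertifiedManyBodySolver.Downfold

open NonemptyInterval Literature.MathematicalPhysics.QuantumLattice
  Literature.MathematicalPhysics.QuantumLattice.ThermodynamicLimit
  Literature.MathematicalPhysics.QuantumLattice.InfVolFermionState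
  Literature.Probability.LatticeModels _root_.Filter
  Summit.Ventures.CertifiedManyBodySolver Summit.Ventures.CertifiedManyBodySolver.Certificates

open scoped ComplexOrder

/-- **hubbard-box-p2's HYPOTHESIS-FREE 2×2-floor ∧ 2×4-WITNESS-CAP word** (kernel `acf2x2` corner floors ∧ kernel `acu2x4` open-cluster witness planes glued by the density chord and `energyDensityTT'_affineCap_Icc₃_of_endPlanes`) ON `boxCCOCM_M36` — OBJECT M, `t–t′–t″` fixed-filling energy density (`acuw_naccocM_M36_word2` read through `boxCCOCM_M36_energyWord_kinematic`,
kinematic `t″` allowance `(16/π²)·(179/1000)`): at every member, `-1.2888648000 − (16/π²)(179/1000) ≤ e^M_n ≤ -0.4174101000 + (16/π²)(179/1000)` — source word hypothesis-free. [cite: Ruelle1969, §3.3] [cite: LiebLoss1993, §8, Theorem 8.2] -/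
theorem boxCCOCM_M36_word_acu_kinematic :
    HoldsOn (fun p : OneBandCoord → ℝ =>
      ((-1611081 : ℝ) / 1250000) - 16 / Real.pi ^ 2 * (179/1000 : ℝ) ≤
          (hubbardTT'T''FermionInteraction 1 (p .tpOverT) (p .tppOverT) (p .UOverT)).tiGroundEnergyDensityAt
            2 (p .filling) ∧
        (hubbardTT'T''FermionInteraction 1 (p .tpOverT) (p .tppOverT) (p .UOverT)).tiGroundEnergyDensityAt
            2 (p .filling) ≤
          ((-4174101 : ℝ) / 10000000) + 16 / Real.pi ^ 2 * (179/1000 : ℝ)) boxCCOCM_M36 :=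
  boxCCOCM_M36_energyWord_kinematic
    acuw_naccocM_M36_word2

/-- **Decimal enclosure** of the object-M word `boxCCOCM_M36_word_acu_kinematic`: `-1.58 ≤ e^M_n ≤ -0.126` (allowance `≤ 0.291`,
`cCOCM_M36_allowance_le`). [folklore] -/
theorem boxCCOCM_M36_word_acu_decimal :
    HoldsOn (fun p : OneBandCoord → ℝ =>
      (-1.58 : ℝ) ≤
          (hubbardTT'T''FermionInteraction 1 (p .tpOverT) (p .tppOverT) (p .UOverT)).tiGroundEnergyDensityAt
            2 (p .filling) ∧
        (hubbardTT'T''FermionInteraction 1 (p .tpOverT) (p .tppOverT) (p .UOverT)).tiGroundEnergyDensityAt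
            2 (p .filling) ≤ (-0.126 : ℝ)) boxCCOCM_M36 := by
  refine (boxCCOCM_M36_word_acu_kinematic ).mono fun p hp => ?_
  have ha := cCOCM_M36_allowance_le
  constructor
  · linarith [hp.1]
  · linarith [hp.2]

/-- **HYPOTHESIS-FREE typed T-axis word on `boxCCOCM_M36` via the thermal annex, acu edition** (box-p2's closed 2×2-floor ∧ 2×4-cap word at `T = 0`; supersedes the caps of `boxCCOCM_M36_ttPrimeThermalAnnex_closed`: 300 K −0.3009 → see below; object M read as its `t–t′` TRUNCATION) (`t₁ = 21/50` eV = the box's `t_eV` floor): for every temperature cell `Θ = [kT₁, kT₂]` (eV, `0 < kT₁`), every `kT ∈ Θ`, member `p`,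
`β' ≥ p t_eV/kT` and every torus-limit sector-Gibbs state of `H(1, p tp/t, p U/t)` at `β'`, filling `p n`:
**`e(ω) ∈ [-1.2888648000, -0.4174101000 + 1.3863·kT₂/(21/50)]`** — D-0099 rows: `T ≤ 300 K` cap **-0.3320800376**, `200 K` -0.3605233917, `150 K` -0.3747450688,
`100 K` **-0.3889667459**, `77 K` -0.3955087173, `50 K` -0.4031884229, `20 K` -0.4117214292, `10 K` -0.4145657646 (k_B = 8.617333×10⁻⁵ eV/K) — the `T = 0` cell word
fed to `holdsOn_thermalAnnex_of_cellWord` (box-p2's Gibbs-variational annex, entropy `≤ log 4`), HYPOTHESIS-FREE (closed `T = 0` word; no thermal certificate).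
[cite: Israel1979, Thm. I.3.4] [cite: Ruelle1969, §2.5–2.6] -/
theorem boxCCOCM_M36_ttPrimeThermalAnnex_acu
    {Θ : NonemptyInterval ℚ} (hΘ : 0 < Θ.fst) {kT : ℝ} (hk : kT ∈ Θ.ratCast ℝ) :
    HoldsOn (fun p : OneBandCoord → ℝ => ∀ β' : ℝ, p .tEV / kT ≤ β' →
      ∀ (ω : InfVolFermionState 2) (Ls : ℕ → ℕ), Tendsto Ls atTop atTop →
        ω.IsTorusLimitOfMixture (sectorGibbsCount (p .filling))
          (fun L => sectorGibbsWeightTT' β' 1 (p .tpOverT) (p .UOverT) (p .filling) L)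
          (fun L => sectorGibbsVectorTT' 1 (p .tpOverT) (p .UOverT) (p .filling) L) Ls →
        ω.meanEnergy (hubbardTTPrimeFermionInteraction 1 (p .tpOverT) (p .UOverT)) 1 ∈
          Set.Icc ((-1611081 : ℝ) / 1250000) (((-4174101 : ℝ) / 10000000) + 1.3863 / ((((21/50 : ℚ) / Θ.snd : ℚ)) : ℝ))) boxCCOCM_M36 :=
  holdsOn_thermalAnnex_of_cellWord (B := boxCCOCM_M36) (eU := cCOCM_M36_U) (eS := cCOCM_M36_tp) (eN := cCOCM_M36_n) (eT := cCOCM_M36_t) rfl rfl rfl rfl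
    (by rw [cCOCM_M36_U, Entry.encl_ofEnds_fst]; norm_num) (by rw [cCOCM_M36_n, Entry.encl_ofEnds_fst]; norm_num)
    (by rw [cCOCM_M36_n, Entry.encl_ofEnds_snd]; norm_num) (by rw [cCOCM_M36_t, Entry.encl_ofEnds_fst]) (by norm_num)
    (by rw [cCOCM_M36_s2Lo, cCOCM_M36_s2Hi]; exact acuw_naccocM_M36_word2) hΘ hk

end Summit.Ventures.CertifiedManyBodySolver.Downfold

end
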